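import Summits.NavierStokesRegularity.NavierStokesRegularity.Theses.FilamentSkeletonRss
import Literature.Analysis.FluidPDE.GaussianWeightedSpace
import Literature.Analysis.FluidPDE.GaussianVortexKernelRadial
import Summits.NavierStokesRegularity.NavierStokesRegularity.Theorems.FilamentSkeletonRssCoreLinearInvertibilityGradientInClass
import Summits.NavierStokesRegularity.NavierStokesRegularity.Theorems.FilamentSkeletonRssCoreLinearInvertibilityClassClosure
import Summits.NavierStokesRegularity.NavierStokesRegularity.Theorems.FilamentSkeletonRssCoreLinearInvertibilityParityTools
import Summits.NavierStokesRegularity.NavierStokesRegularity.Theorems.FilamentSkeletonRssCoreLinearInvertibilityCoreBoundLamZero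
import Summits.NavierStokesRegularity.NavierStokesRegularity.Theorems.FilamentSkeletonRssCoreLinearInvertibilityCoreBoundEven
import Summits.NavierStokesRegularity.NavierStokesRegularity.Theorems.FilamentSkeletonRssCoreLinearInvertibilityOddSymmetrizerBounds
import Summits.NavierStokesRegularity.NavierStokesRegularity.Theorems.FilamentSkeletonRssCoreLinearInvertibilityOddArnold
import Summits.NavierStokesRegularity.NavierStokesRegularity.Theorems.FilamentSkeletonRssCoreLinearInvertibilityOddAttenuation

/-!
# Route FilamentSkeletonRss · crux `CoreLinearInvertibility` (stmt-NavierStokesRegularity-17973) — line `Sketch`, skeleton (lead 0)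

`CoreLinearInvertibility`: for every asymmetry `λ ∈ [0,1)` there are `R₀, c > 0` such that for all
`R ≥ R₀` the linearised strained planar core operator at the Gaussian core,
`T_{λ,R} w = L_λ w − R (v^G·∇w + (K_{2D}∗w)·∇G)` (`strainedVorticityOperator`, `gaussVortexVelocity`,
`biotSavart2D`, `gaussVortexProfile` of `Literature.Analysis.FluidPDE.GaussianVortexPlanar`), obeys
`c² ∫ G_λ⁻¹ w² ≤ ∫ G_λ⁻¹ (T_{λ,R} w)²` (`G_λ = gaussWeightLam λ`) for every `C²` vorticity `w` with
`w, T w ∈ X_λ = L²(G_λ⁻¹)`, pointwise convergent Biot–Savart integrals and zero mass and first moments.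

Skeleton of line `Sketch` (ideator 2: cards `capacitance-split`, `xlam-rotation-multiplier`, frame
`dual-schwartz-solvability`), RESHAPED by the lead (PICKED.md):

* CLASS CLOSURE (replaces the duality frame; the parent lead's AUDIT-17973-c12 §3 "maximal domain"
  caveat handled inside the proof, no restatement):
  `stub_gradientInClass` — for `w` in the crux class, `∇w ∈ X_λ` (χ²-truncated `X_λ` energy identity:
  `‖χ∇w‖² + (λ(1−λ)/4)‖χx₀w‖² = −⟨T w, χ²w⟩ + (1−λ/2)‖χw‖² + R⟨Λ_nl w, χ²w⟩ + O(∇χ)`, the local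
  rotation `v^G·∇` dropping out exactly for radial `χ`, the Biot–Savart term bounded by a Schur test);
  `stub_classClosure` — radial cut-offs plus a three-dimensional moment correction converge to `w` in the
  GRAPH norm of `T` (uses `∇w ∈ X_λ`), so the bound passes from `C²_c` zero-moment vorticities to the class.
* PARITY SPLIT of the `C²_c` a-priori bound (`T` commutes with `x ↦ −x`, even/odd parts are
  `X_λ`-orthogonal, mass constrains the even part and first moments the odd part): `stub_parityTools`
  (bookkeeping), `stub_coreBoundEven` (Maekawa, M3AS 19 (2009) §4 (4.9): IN PRINT on his domain
  `D(L_λ) ⊇ C²_c`), `stub_coreBoundOdd` (NOT in print: the new mathematics of the crux — capacitance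
  split / forward symmetrizer + attenuation of `L_λ − RΩ∂_θ`; numerics kit j024428, j025050, j025052,
  j025148: `σ_min` on odd zero-moment functions grows like `R^{1/2}` for `λ ≤ .9`).
* `stub_coreBoundLamZero` — the `λ = 0` instance with `c = 1/2` for EVERY `R` (Gallay–Wayne: `Λ_G` is
  skew in `L²(G⁻¹)`, `⟨Lw,w⟩ ≤ −½‖w‖²` on mass-zero `w` by the Gaussian Poincaré inequality — both in the
  tree: `inner_biotSavart2D_eq_zero_of_radial`-style symmetry, `integral_strainedVorticityOperator_mul_div_le`).

`CoreLinearInvertibility_of` composes: (λ = 0) closure + λ-zero bound; (λ ∈ (0,1)) closure + parity +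
even/odd bounds with `c = min(c_e, c_o, 1/2)`, `R₀ = max(R₀ᵉ, R₀ᵒ)`; limits by `le_of_tendsto_of_tendsto'`.

LANDED (wave 1, 2026-08-17): `stub_gradientInClass` p161986 (+ tools p161572, p161390), `stub_classClosure`
p161877 (+ tools p160349, p161005, p161067, p161516, p161517), `stub_parityTools` p160591 (+ p160320),
`stub_coreBoundLamZero` p159715 — imported above; OPEN: `stub_coreBoundEven` (Maekawa 2009 Lemma 4.1, to be
vendored as the Literature fact `Maekawa2009_evenSectorInverseBound`, p162581/p162582 pending), and the odd sector,
RESHAPED (cycle 1) from `stub_coreBoundOdd` into `stub_oddSymmetrizerBounds` (provable now),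
`stub_oddSymmetrizerBoundedBelow` (Fredholm), `stub_oddAttenuation` (the new estimate), composed by the proved
`coreBoundOdd_of_symmetrizer`.
-/

set_option linter.dupNamespace false

noncomputable section

namespace Summit.NavierStokesRegularity.NavierStokesRegularity.Theorems

open Set Function Filter MeasureTheory Topology
open Literature.Analysis.FluidPDE
open scoped InnerProductSpace Laplacian ContDiff

-- stub_gradientInClass: LANDED p161986 in Theorems/FilamentSkeletonRssCoreLinearInvertibilityGradientInClass.lean (imported above).

-- stub_classClosure: LANDED p161877 in Theorems/FilamentSkeletonRssCoreLinearInvertibilityClassClosure.lean (imported above).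

-- stub_parityTools: LANDED p160591 in Theorems/FilamentSkeletonRssCoreLinearInvertibilityParityTools.lean (imported above).

-- stub_coreBoundLamZero: LANDED p159715 in Theorems/FilamentSkeletonRssCoreLinearInvertibilityCoreBoundLamZero.lean (imported above).

/-- **Stub 5 (even sector = a Literature named fact).** Maekawa, M3AS 19 (2009), Lemma 4.1 (4.1): the
uniform-in-`|α| ≥ Θ(λ)` inverse bound for `L + λM − αΛ_G` on `𝒫ᵉ X_λ`, vendored (p162581) as
`Literature.Analysis.FluidPDE.Maekawa2009_evenSectorInverseBound` in its a-priori form on `C²_c` even mass-zero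
vorticities. This stub IS the named fact (closed the day a literature-prover lands `…_holds`); the even-sector
bound follows by the landed tools stub `stub_coreBoundEvenOfMaekawa2009` (p162582). Registered stub of crux
stmt-NavierStokesRegularity-17973, line `Sketch`. -/
theorem stub_maekawa2009Even : Literature.Analysis.FluidPDE.Maekawa2009_evenSectorInverseBound := by
  sorry

/-- **The even sector** (former registered stub `stub_coreBoundEven`, reshape cycle 1): from the
Literature fact by the landed reduction `stub_coreBoundEvenOfMaekawa2009` (`R₀ = |Θ(λ)|`, `c = C(λ)⁻¹`). -/
theorem coreBoundEven_of_maekawa :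
    ∀ lam ∈ Set.Ico (0 : ℝ) 1, ∃ R₀ c : ℝ, 0 < c ∧ ∀ R : ℝ, R₀ ≤ R →
    ∀ w : EuclideanSpace ℝ (Fin 2) → ℝ, ContDiff ℝ 2 w → HasCompactSupport w →
    (∀ x, w (-x) = w x) → ∫ x, w x = 0 →
    c ^ 2 * ∫ x, (gaussWeightLam lam x)⁻¹ * w x ^ 2 ≤
      ∫ x, (gaussWeightLam lam x)⁻¹ * (strainedVorticityOperator lam w x -
        R * (⟪gaussVortexVelocity x, gradient w x⟫_ℝ +
          ⟪biotSavart2D w x, gradient gaussVortexProfile x⟫_ℝ)) ^ 2 :=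
  stub_coreBoundEvenOfMaekawa2009 stub_maekawa2009Even

/-- Weighted squares integrate to a nonnegative number (`G_λ > 0` for `λ < 1`). [folklore] -/
theorem integral_inv_gaussWeightLam_mul_sq_nonneg {lam : ℝ} (hlam : lam < 1)
    (f : EuclideanSpace ℝ (Fin 2) → ℝ) :
    0 ≤ ∫ x, (gaussWeightLam lam x)⁻¹ * f x ^ 2 :=
  integral_nonneg fun x => mul_nonneg (inv_nonneg.2 (gaussWeightLam_pos hlam x).le) (sq_nonneg _)

/-! ### The odd sector (the new mathematics), reshaped by the lead (cycle 1)

Forward skew-symmetrisation (Maekawa's substitution read forward; cards `forward-symmetrizer-moment-fredholm`,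
`capacitance-split`): for `w ∈ C²_c` put `ψ_w = N∗w` (`N = (2π)⁻¹ log|·|`, so `Δψ_w = w`, `K∗w = (∇ψ_w)^⊥`,
`x·(K∗w) = −∂_θψ_w`) and `u_w = Φ(|x|) ψ_w` with `Φ = kerWeight = G/(2Ω)`.  Then `v^G·∇u_w = ΩΦ ∂_θψ_w =
(G/2)∂_θψ_w = (K∗w)·∇G` POINTWISE, i.e. `Λ_a u_w = Λ_b w`, hence the exact identity
`T_{λ,R} w = H_{λ,R}(w + u_w) − L_λ u_w` with the LOCAL operator `H_{λ,R} = L_λ − R v^G·∇ = L_λ − RΩ∂_θ`.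
For ODD `w` with zero first moments: `‖T w‖ ≥ ‖H v‖ − ‖L_λ u_w‖ ≥ ε⁻¹‖v‖ − C₁‖w‖ ≥ (ε⁻¹C_V⁻¹ − C₁)‖w‖`, `v = w + u_w`, from
* `stub_oddSymmetrizerBounds` (provable now: `u_w ∈ C²`, odd, Gaussian class, the pointwise identity, `‖L_λ u_w‖ ≤ C₁‖w‖`);
* `stub_oddSymmetrizerBoundedBelow` (`‖w‖ ≤ C_V ‖w + u_w‖` on {odd, first moments 0}: `I + K` is `I +` Hilbert–Schmidt on
  `X_λ^odd` with kernel `span{∂₁G, ∂₂G}` — tree `radialMode_one_eq_smul`, `radialMode_eq_zero` — and the moments pair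
  non-degenerately with it; Fredholm: `Literature/Analysis/OperatorTheory/CompactPerturbationClosedRange`);
* `stub_oddAttenuation` (high-rotation attenuation of the LOCAL operator on odd Gaussian-class functions, `∀ ε ∃ R₀`:
  angular-momentum multiplier `∂_θ` + `X_λ` energy identity + radial two-zone split, card
  `angular-momentum-multiplier-attenuation`; numerics kit j025050/j025052: `σ_min(H|odd) ≈ R^{1/2}` for `λ ≤ .9`).
-/

-- stub_oddSymmetrizerBounds: LANDED p167124 in Theorems/FilamentSkeletonRssCoreLinearInvertibilityOddSymmetrizerBounds.lean (+ tools p164787, p165489, p165938, p166327; imported above).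


/-- **Stub 6b (= a Literature named fact).** Gallay–Šverák 2021 (Analysis & PDE 2024), Thm. 2.5 with Rem. 2.7 at
the Gaussian: coercivity of Arnold's quadratic form `∫ ω²/Φ + ∫ ω ψ_ω ≥ γ ∫ ω²/Φ` on odd Gaussian-class densities
with zero first moments, vendored (p166242) as `Literature.Analysis.FluidPDE.GallaySverak2021_thm25_gaussian`.
This stub IS the named fact; the bounded-belowness of the symmetrizer on the moment-free odd space follows by
the landed tools stub `stub_oddSymmetrizerBoundedBelowOfArnold` (p167244: `K̃` maps `X_λ` into `L²(Φ⁻¹)`,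
the form bound, a moment correction, and `G_λ⁻¹ ≤ C_λ Φ⁻¹` for `λ > 0`). Registered stub of crux
stmt-NavierStokesRegularity-17973, line `Sketch`. -/
theorem stub_gallaySverak2021 : Literature.Analysis.FluidPDE.GallaySverak2021_thm25_gaussian := by
  sorry

/-- **The symmetrizer is bounded below on the moment-free odd space** (former registered stub
`stub_oddSymmetrizerBoundedBelow`, reshape cycle 1): from the Literature fact by the landed reduction. -/
theorem oddSymmetrizerBoundedBelow_of_arnold :
    ∀ lam ∈ Set.Ioo (0 : ℝ) 1, ∃ C : ℝ, 0 < C ∧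
    ∀ (w ψ u : EuclideanSpace ℝ (Fin 2) → ℝ), ContDiff ℝ 2 w → HasCompactSupport w →
    (∀ x, w (-x) = -w x) → ∫ x, x 0 * w x = 0 → ∫ x, x 1 * w x = 0 →
    (∀ x, ψ x = ∫ y, (2 * Real.pi)⁻¹ * Real.log ‖x - y‖ * w y) →
    (∀ x, u x = kerWeight ‖x‖ * ψ x) →
    ∫ x, (gaussWeightLam lam x)⁻¹ * w x ^ 2 ≤
      C ^ 2 * ∫ x, (gaussWeightLam lam x)⁻¹ * (w x + u x) ^ 2 :=
  stub_oddSymmetrizerBoundedBelowOfArnold stub_gallaySverak2021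


-- stub_oddAttenuation: LANDED p168798 in Theorems/FilamentSkeletonRssCoreLinearInvertibilityOddAttenuation.lean (+ tools p165057, p165834, p166116, p167466, p167994, p168520, p168633, p167444; imported above).


/-- Weighted Minkowski inequality: `√∫ g (a+b)² ≤ √∫ g a² + √∫ g b²` for a weight `g ≥ 0` with
`g a², g b² ∈ L¹` (from the weighted Cauchy–Schwarz inequality of `…ClassClosureToolsA`). [folklore] -/
theorem sqrt_integral_weight_mul_add_sq_le {g a b : EuclideanSpace ℝ (Fin 2) → ℝ}
    (hg : ∀ x, 0 ≤ g x) (hgm : AEStronglyMeasurable g volume)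
    (ham : AEStronglyMeasurable a volume) (hbm : AEStronglyMeasurable b volume)
    (ha : Integrable (fun x => g x * a x ^ 2)) (hb : Integrable (fun x => g x * b x ^ 2)) :
    Real.sqrt (∫ x, g x * (a x + b x) ^ 2) ≤
      Real.sqrt (∫ x, g x * a x ^ 2) + Real.sqrt (∫ x, g x * b x ^ 2) := by
  obtain ⟨hab, hcs⟩ := abs_integral_weight_mul_mul_le (μ := volume) hg hgm ham hbm ha hb
  have hA : 0 ≤ ∫ x, g x * a x ^ 2 := integral_nonneg fun x => mul_nonneg (hg x) (sq_nonneg _)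
  have hB : 0 ≤ ∫ x, g x * b x ^ 2 := integral_nonneg fun x => mul_nonneg (hg x) (sq_nonneg _)
  have hexp : ∫ x, g x * (a x + b x) ^ 2 =
      (∫ x, g x * a x ^ 2) + 2 * (∫ x, g x * (a x * b x)) + ∫ x, g x * b x ^ 2 := by
    have e : (fun x => g x * (a x + b x) ^ 2) =
        fun x => (g x * a x ^ 2 + 2 * (g x * (a x * b x))) + g x * b x ^ 2 := by
      funext x; ring
    have h2 : Integrable (fun x => 2 * (g x * (a x * b x))) := hab.const_mul 2
    have h1 : Integrable (fun x => g x * a x ^ 2 + 2 * (g x * (a x * b x))) := ha.add h2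
    rw [e, integral_add h1 hb, integral_add ha h2, integral_const_mul]
  have hle : ∫ x, g x * (a x + b x) ^ 2 ≤
      (Real.sqrt (∫ x, g x * a x ^ 2) + Real.sqrt (∫ x, g x * b x ^ 2)) ^ 2 := by
    rw [hexp, add_sq, Real.sq_sqrt hA, Real.sq_sqrt hB]
    have := (abs_le.1 hcs).2
    nlinarith
  calc Real.sqrt (∫ x, g x * (a x + b x) ^ 2)
      ≤ Real.sqrt ((Real.sqrt (∫ x, g x * a x ^ 2) + Real.sqrt (∫ x, g x * b x ^ 2)) ^ 2) :=
        Real.sqrt_le_sqrt hle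
    _ = Real.sqrt (∫ x, g x * a x ^ 2) + Real.sqrt (∫ x, g x * b x ^ 2) :=
        Real.sqrt_sq (add_nonneg (Real.sqrt_nonneg _) (Real.sqrt_nonneg _))

/-- **The odd sector from the forward symmetrizer** (`stub_oddSymmetrizerBounds`,
`stub_oddSymmetrizerBoundedBelow`, `stub_oddAttenuation`): with `C₁, C_V` from 6a, 6b,
`ε = (2 C_V (C₁+1))⁻¹` and `R₀` from 6c, every odd `C²_c` vorticity with zero first moments obeys
`(C₁+1)² ‖w‖²_{X_λ} ≤ ‖T_{λ,R} w‖²_{X_λ}` for `R ≥ R₀`: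
`‖w‖ ≤ C_V‖v‖ ≤ C_V ε ‖Hv‖ ≤ C_V ε (‖Tw‖ + C₁‖w‖)`. This is the body of the former registered stub
`stub_coreBoundOdd` (reshape, cycle 1). -/
theorem coreBoundOdd_of_symmetrizer :
    ∀ lam ∈ Set.Ioo (0 : ℝ) 1, ∃ R₀ c : ℝ, 0 < c ∧ ∀ R : ℝ, R₀ ≤ R →
    ∀ w : EuclideanSpace ℝ (Fin 2) → ℝ, ContDiff ℝ 2 w → HasCompactSupport w →
    (∀ x, w (-x) = -w x) → ∫ x, x 0 * w x = 0 → ∫ x, x 1 * w x = 0 →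
    c ^ 2 * ∫ x, (gaussWeightLam lam x)⁻¹ * w x ^ 2 ≤
      ∫ x, (gaussWeightLam lam x)⁻¹ * (strainedVorticityOperator lam w x -
        R * (⟪gaussVortexVelocity x, gradient w x⟫_ℝ +
          ⟪biotSavart2D w x, gradient gaussVortexProfile x⟫_ℝ)) ^ 2 := by
  intro lam hlam
  have hlam1 : lam < 1 := hlam.2
  obtain ⟨C₁, hC₁, h1⟩ := stub_oddSymmetrizerBounds lam hlam
  obtain ⟨CV, hCV, h2⟩ := oddSymmetrizerBoundedBelow_of_arnold lam hlam
  set ε : ℝ := (2 * CV * (C₁ + 1))⁻¹ with hε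
  have hC1pos : 0 < C₁ + 1 := by linarith
  have hεpos : 0 < ε := by rw [hε]; positivity
  obtain ⟨R₀, h3⟩ := stub_oddAttenuation lam hlam ε hεpos
  refine ⟨R₀, C₁ + 1, hC1pos, fun R hR w hw hws hodd hm1 hm2 => ?_⟩
  -- the symmetrizer
  set ψ : EuclideanSpace ℝ (Fin 2) → ℝ := fun x => ∫ y, (2 * Real.pi)⁻¹ * Real.log ‖x - y‖ * w y
    with hψ
  set u : EuclideanSpace ℝ (Fin 2) → ℝ := fun x => kerWeight ‖x‖ * ψ x with hu
  obtain ⟨huC2, huodd, hclass, hident, hIw, hITw, hIv, hILu, hIH, hcLu, hcH, hLu⟩ :=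
    h1 w ψ u hw hws hodd (fun x => rfl) (fun x => rfl)
  have hvodd : ∀ x, (fun y => w y + u y) (-x) = -(fun y => w y + u y) x := by
    intro x; simp only [hodd x, huodd x]; ring
  have hatt := h3 R hR (fun y => w y + u y) (hw.add huC2) hvodd hclass
  have hbelow := h2 w ψ u hw hws hodd hm1 hm2 (fun x => rfl) (fun x => rfl)
  -- abbreviations for the five weighted squares
  set A := ∫ x, (gaussWeightLam lam x)⁻¹ * w x ^ 2 with hA
  set Tsq := ∫ x, (gaussWeightLam lam x)⁻¹ * (strainedVorticityOperator lam w x -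
        R * (⟪gaussVortexVelocity x, gradient w x⟫_ℝ +
          ⟪biotSavart2D w x, gradient gaussVortexProfile x⟫_ℝ)) ^ 2 with hTsq
  set Lsq := ∫ x, (gaussWeightLam lam x)⁻¹ * (strainedVorticityOperator lam u x) ^ 2 with hLsq
  set Hsq := ∫ x, (gaussWeightLam lam x)⁻¹ * (strainedVorticityOperator lam (fun y => w y + u y) x -
        R * ⟪gaussVortexVelocity x, gradient (fun y => w y + u y) x⟫_ℝ) ^ 2 with hHsq
  set Vsq := ∫ x, (gaussWeightLam lam x)⁻¹ * (w x + u x) ^ 2 with hVsq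
  have hA0 : 0 ≤ A := integral_inv_gaussWeightLam_mul_sq_nonneg hlam1 _
  have hT0 : 0 ≤ Tsq := integral_inv_gaussWeightLam_mul_sq_nonneg hlam1 _
  have hL0 : 0 ≤ Lsq := integral_inv_gaussWeightLam_mul_sq_nonneg hlam1 _
  have hH0 : 0 ≤ Hsq := integral_inv_gaussWeightLam_mul_sq_nonneg hlam1 _
  have hV0 : 0 ≤ Vsq := integral_inv_gaussWeightLam_mul_sq_nonneg hlam1 _
  -- Minkowski: √Hsq ≤ √Tsq + √Lsq, since H(w+u) = T w + L_λ u pointwise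
  have hmink : Real.sqrt Hsq ≤ Real.sqrt Tsq + Real.sqrt Lsq := by
    have key := sqrt_integral_weight_mul_add_sq_le
      (fun x => (inv_nonneg.2 (gaussWeightLam_pos hlam1 x).le))
      (continuous_inv_gaussWeightLam hlam1).aestronglyMeasurable
      (parity_aestronglyMeasurable_coreOp lam R hw) hcLu.aestronglyMeasurable (hITw R) hILu
    have e : (fun x => (gaussWeightLam lam x)⁻¹ * (strainedVorticityOperator lam w x -
        R * (⟪gaussVortexVelocity x, gradient w x⟫_ℝ +
          ⟪biotSavart2D w x, gradient gaussVortexProfile x⟫_ℝ) +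
        strainedVorticityOperator lam u x) ^ 2) =
        fun x => (gaussWeightLam lam x)⁻¹ * (strainedVorticityOperator lam (fun y => w y + u y) x -
          R * ⟪gaussVortexVelocity x, gradient (fun y => w y + u y) x⟫_ℝ) ^ 2 := by
      funext x; rw [hident R x]; ring
    rw [e] at key
    exact key
  -- square roots of the three stub inequalities
  have hsV : Real.sqrt Vsq ≤ ε * Real.sqrt Hsq := by
    calc Real.sqrt Vsq ≤ Real.sqrt (ε ^ 2 * Hsq) := Real.sqrt_le_sqrt hatt
      _ = ε * Real.sqrt Hsq := by rw [Real.sqrt_mul (sq_nonneg _), Real.sqrt_sq hεpos.le]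
  have hsA : Real.sqrt A ≤ CV * Real.sqrt Vsq := by
    calc Real.sqrt A ≤ Real.sqrt (CV ^ 2 * Vsq) := Real.sqrt_le_sqrt hbelow
      _ = CV * Real.sqrt Vsq := by rw [Real.sqrt_mul (sq_nonneg _), Real.sqrt_sq hCV.le]
  have hsL : Real.sqrt Lsq ≤ C₁ * Real.sqrt A := by
    calc Real.sqrt Lsq ≤ Real.sqrt (C₁ ^ 2 * A) := Real.sqrt_le_sqrt hLu
      _ = C₁ * Real.sqrt A := by rw [Real.sqrt_mul (sq_nonneg _), Real.sqrt_sq hC₁]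
  -- bookkeeping: √A ≤ CV ε (√T + C₁ √A) and CV ε = (2(C₁+1))⁻¹
  have hCVε : CV * ε = (2 * (C₁ + 1))⁻¹ := by
    rw [hε]; field_simp
  have hsT0 : 0 ≤ Real.sqrt Tsq := Real.sqrt_nonneg _
  have hsA0 : 0 ≤ Real.sqrt A := Real.sqrt_nonneg _
  have hchain : Real.sqrt A ≤ (2 * (C₁ + 1))⁻¹ * (Real.sqrt Tsq + C₁ * Real.sqrt A) := by
    calc Real.sqrt A ≤ CV * Real.sqrt Vsq := hsA
      _ ≤ CV * (ε * Real.sqrt Hsq) := mul_le_mul_of_nonneg_left hsV hCV.le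
      _ = (CV * ε) * Real.sqrt Hsq := by ring
      _ ≤ (CV * ε) * (Real.sqrt Tsq + Real.sqrt Lsq) :=
          mul_le_mul_of_nonneg_left hmink (by rw [hCVε]; positivity)
      _ ≤ (CV * ε) * (Real.sqrt Tsq + C₁ * Real.sqrt A) := by
          apply mul_le_mul_of_nonneg_left _ (by rw [hCVε]; positivity); linarith
      _ = (2 * (C₁ + 1))⁻¹ * (Real.sqrt Tsq + C₁ * Real.sqrt A) := by rw [hCVε]
  have hfinal : (C₁ + 1) * Real.sqrt A ≤ Real.sqrt Tsq := by
    have h2pos : 0 < 2 * (C₁ + 1) := by positivity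
    have := mul_le_mul_of_nonneg_left hchain h2pos.le
    rw [← mul_assoc, mul_inv_cancel₀ h2pos.ne', one_mul] at this
    nlinarith
  -- square it
  have hsq := pow_le_pow_left₀ (mul_nonneg hC1pos.le hsA0) hfinal 2
  rw [mul_pow, Real.sq_sqrt hA0, Real.sq_sqrt hT0] at hsq
  exact hsq


/-- **Composition.** The crux `CoreLinearInvertibility` BY NAME from the six stubs: class closure
(`stub_gradientInClass`, `stub_classClosure`) reduces to `C²_c` zero-moment vorticities; there the bound
is `stub_coreBoundLamZero` at `λ = 0` and, for `λ ∈ (0,1)`, the parity split (`stub_parityTools`) with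
`stub_coreBoundEven`, `stub_coreBoundOdd`, `c = min(c_e, c_o, 1/2)`, `R₀ = max(R₀ᵉ, R₀ᵒ)`; the
inequality passes to the limit along the closure sequence. -/
theorem CoreLinearInvertibility_of :
    Summit.NavierStokesRegularity.NavierStokesRegularity.Theses.FilamentSkeletonRss.CoreLinearInvertibility := by
  intro lam hlam
  have hlam1 : lam < 1 := hlam.2
  -- constants from the two parity sectors (the odd ones are only needed for `λ ∈ (0,1)`;
  -- at `λ = 0` the λ-zero stub covers both parities, so we feed the odd reduction `λ = 1/2` there)
  obtain ⟨R₀e, ce, hce, hE⟩ := coreBoundEven_of_maekawa lam hlam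
  have hlam' : (if lam = 0 then (1 / 2 : ℝ) else lam) ∈ Set.Ioo (0 : ℝ) 1 := by
    split_ifs with h
    · constructor <;> norm_num
    · exact ⟨lt_of_le_of_ne hlam.1 (Ne.symm h), hlam.2⟩
  obtain ⟨R₀o, co, hco, hO⟩ := coreBoundOdd_of_symmetrizer _ hlam'
  refine ⟨max R₀e R₀o, min (min ce co) (1 / 2), lt_min (lt_min hce hco) (by norm_num), ?_⟩
  intro R hR w hw hwX hBS hTX hm0 hm1 hm2
  have hc0 : 0 ≤ min (min ce co) (1 / 2) := (lt_min (lt_min hce hco) (by norm_num)).le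
  have hmin_e : (min (min ce co) (1 / 2)) ^ 2 ≤ ce ^ 2 :=
    pow_le_pow_left₀ hc0 ((min_le_left _ _).trans (min_le_left _ _)) 2
  have hmin_o : (min (min ce co) (1 / 2)) ^ 2 ≤ co ^ 2 :=
    pow_le_pow_left₀ hc0 ((min_le_left _ _).trans (min_le_right _ _)) 2
  have hmin_z : (min (min ce co) (1 / 2)) ^ 2 ≤ (1 / 2) ^ 2 :=
    pow_le_pow_left₀ hc0 (min_le_right _ _) 2
  -- the a-priori bound on C²_c zero-moment vorticities, constant `min (min ce co) (1/2)`
  have hcore : ∀ v : EuclideanSpace ℝ (Fin 2) → ℝ, ContDiff ℝ 2 v → HasCompactSupport v →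
      ∫ x, v x = 0 → ∫ x, x 0 * v x = 0 → ∫ x, x 1 * v x = 0 →
      (min (min ce co) (1 / 2)) ^ 2 * ∫ x, (gaussWeightLam lam x)⁻¹ * v x ^ 2 ≤
        ∫ x, (gaussWeightLam lam x)⁻¹ * (strainedVorticityOperator lam v x -
          R * (⟪gaussVortexVelocity x, gradient v x⟫_ℝ +
            ⟪biotSavart2D v x, gradient gaussVortexProfile x⟫_ℝ)) ^ 2 := by
    intro v hv hvs hv0 hv1 hv2
    by_cases h0 : lam = 0
    · subst h0
      have hz := stub_coreBoundLamZero R v hv hvs hv0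
      have hnn := integral_inv_gaussWeightLam_mul_sq_nonneg hlam1 v
      nlinarith
    · obtain ⟨hec, hes, hoc, hos, heven, hodd, hme, hm1o, hm2o, hsplit, hsplitT⟩ :=
        stub_parityTools lam hlam R v hv hvs
      have hRe : R₀e ≤ R := (le_max_left _ _).trans hR
      have hRo : R₀o ≤ R := (le_max_right _ _).trans hR
      have he := hE R hRe (fun x => (v x + v (-x)) / 2) hec hes heven (by rw [hme, hv0])
      rw [if_neg h0] at hO
      have ho := hO R hRo (fun x => (v x - v (-x)) / 2) hoc hos hodd (by rw [hm1o, hv1])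
        (by rw [hm2o, hv2])
      have hnn_e := integral_inv_gaussWeightLam_mul_sq_nonneg hlam1 (fun x => (v x + v (-x)) / 2)
      have hnn_o := integral_inv_gaussWeightLam_mul_sq_nonneg hlam1 (fun x => (v x - v (-x)) / 2)
      rw [hsplit, hsplitT]
      nlinarith
  -- closure: pass from the C²_c sequence to `w`
  have hgrad := stub_gradientInClass lam hlam R w hw hwX hBS hTX
  obtain ⟨ws, hws, hlimw, hlimT⟩ := stub_classClosure lam hlam R w hw hwX hBS hTX hgrad hm0 hm1 hm2
  have hk : ∀ k, (min (min ce co) (1 / 2)) ^ 2 * ∫ x, (gaussWeightLam lam x)⁻¹ * ws k x ^ 2 ≤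
      ∫ x, (gaussWeightLam lam x)⁻¹ * (strainedVorticityOperator lam (ws k) x -
        R * (⟪gaussVortexVelocity x, gradient (ws k) x⟫_ℝ +
          ⟪biotSavart2D (ws k) x, gradient gaussVortexProfile x⟫_ℝ)) ^ 2 := fun k =>
    hcore (ws k) (hws k).1 (hws k).2.1 (hws k).2.2.1 (hws k).2.2.2.1 (hws k).2.2.2.2
  exact le_of_tendsto_of_tendsto' (hlimw.const_mul _) hlimT hk

end Summit.NavierStokesRegularity.NavierStokesRegularity.Theorems
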